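import Summits.Ventures.PercRepro.S1TriangleSevenF

/-!
# PercRepro — the triangle cap at nullity `8`: `P(8) = 13`, PART A — the reduction (p3, gen 22)

The census value `P(8) = 13` (P3-TRIANGLE-CAP.md §4, two seats) is one below p2's kernel bound `14`
(`S1.ncard_triangles_le_fourteen_of_nullity_eight`). This file is the first part of the paper proof of §10d:
on a coloop-free matroid with (C1)–(C3), nullity `8` and `≥ 14` triangles,

* every point lies on `≥ 3` triangles (`three_le_degree_of_fourteen`: deleting it leaves nullity `7`, where `s₃ ≤ 11`);
* `13 ≤ |E| ≤ 14` and the rank is `5` or `6` (`ncard_ground_le_fourteen`, `exists_rank_of_fourteen`);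
* some point lies on exactly `3` triangles (`exists_degree_three_of_fourteen`).

Axioms: standard.
-/

open scoped Matroid

namespace PercRepro

namespace TriangleCap

open Set

variable {α : Type}

/-- (C3) survives a single-point deletion. -/
theorem hC3_delete (M : Matroid α) (hC3 : ∀ X ⊆ M.E, M.eRk X ≤ 4 → X.ncard ≤ 10) (x : α) :
    ∀ X ⊆ (M ＼ {x}).E, (M ＼ {x}).eRk X ≤ 4 → X.ncard ≤ 10 := by
  intro X hX hr
  rw [_root_.Matroid.delete_ground] at hX
  rw [delete_singleton_eRk_eq hX] at hr
  exact hC3 X (hX.trans Set.sdiff_subset) hr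

/-- **Every point of a coloop-free nullity-`8` matroid with `≥ 14` triangles lies on `≥ 3` of them**
(deleting it leaves nullity `7`, where `s₃ ≤ 11`). -/
theorem three_le_degree_of_fourteen (M : Matroid α) [M.Finite]
    (hC1 : ∀ L ⊆ M.E, M.eRk L = 2 → L.ncard ≤ 3) (hC2 : ∀ P ⊆ M.E, M.eRk P ≤ 3 → P.ncard ≤ 6)
    (hC3 : ∀ X ⊆ M.E, M.eRk X ≤ 4 → X.ncard ≤ 10) (hd : M.E.encard = M.eRank + ((8 : ℕ) : ℕ∞))
    (hcol : ∀ x ∈ M.E, ¬ M.IsColoop x) (hs : 14 ≤ (ThmN.triangles M).ncard)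
    {y : α} (hy : y ∈ M.E) : 3 ≤ (ThmN.trianglesThrough M y).ncard := by
  obtain ⟨hd', hC1', hC2', hle⟩ :=
    S1.ncard_triangles_le_add_of_not_isColoop M hC1 hC2 (d := 7) hd hy (hcol y hy)
  have h11 := S1.ncard_triangles_le_eleven_of_nullity_seven (M ＼ {y}) hC1' hC2' (hC3_delete M hC3 y) hd'
  omega

/-- With every degree `≥ 3` and `14` triangles, `|E| ≤ 14`. -/
theorem ncard_ground_le_fourteen (M : Matroid α) [M.Finite]
    (hdeg : ∀ y ∈ M.E, 3 ≤ (ThmN.trianglesThrough M y).ncard) (hs : (ThmN.triangles M).ncard = 14) :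
    M.E.ncard ≤ 14 := by
  have := S1.mul_ncard_ground_le_three_mul_ncard_triangles M 3 hdeg
  omega

/-- The rank of a nullity-`8` matroid with a triangle and (C1)–(C3) is a natural number `r ≥ 5`, and `|E| = r + 8`. -/
theorem exists_rank_of_fourteen (M : Matroid α) [M.Finite]
    (hC1 : ∀ L ⊆ M.E, M.eRk L = 2 → L.ncard ≤ 3) (hC2 : ∀ P ⊆ M.E, M.eRk P ≤ 3 → P.ncard ≤ 6)
    (hC3 : ∀ X ⊆ M.E, M.eRk X ≤ 4 → X.ncard ≤ 10) (hd : M.E.encard = M.eRank + ((8 : ℕ) : ℕ∞))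
    (hs : 14 ≤ (ThmN.triangles M).ncard) :
    ∃ r : ℕ, M.eRank = (r : ℕ∞) ∧ M.E.ncard = r + 8 ∧ 5 ≤ r := by
  have hSfin : (ThmN.triangles M).Finite :=
    M.ground_finite.finite_subsets.subset (fun C hC => hC.1.subset_ground)
  obtain ⟨C, hC⟩ : (ThmN.triangles M).Nonempty := by
    rw [← Set.ncard_pos hSfin]; omega
  obtain ⟨r, hr, hnr, hr2⟩ := S1.two_add_le_eRank_of_triangle M hd hC
  refine ⟨r, hr, hnr, ?_⟩
  have hE2 : r ≠ 2 ∨ M.E.ncard ≤ 3 := by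
    by_cases h : r = 2
    · refine Or.inr (hC1 M.E (subset_refl _) ?_)
      rw [← _root_.Matroid.eRank_def, hr, h]; norm_num
    · exact Or.inl h
  have hE3 : r ≠ 3 ∨ M.E.ncard ≤ 6 := by
    by_cases h : r = 3
    · refine Or.inr (hC2 M.E (subset_refl _) ?_)
      rw [← _root_.Matroid.eRank_def, hr, h]; norm_num
    · exact Or.inl h
  have hE4 : r ≠ 4 ∨ M.E.ncard ≤ 10 := by
    by_cases h : r = 4
    · refine Or.inr (hC3 M.E (subset_refl _) ?_)
      rw [← _root_.Matroid.eRank_def, hr, h]; norm_num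
    · exact Or.inl h
  omega

/-- **Some point has degree exactly `3`**: if every degree were `≥ 4` then `4|E| ≤ 42`, against `|E| ≥ 13`. -/
theorem exists_degree_three_of_fourteen (M : Matroid α) [M.Finite]
    (hdeg : ∀ y ∈ M.E, 3 ≤ (ThmN.trianglesThrough M y).ncard) (hs : (ThmN.triangles M).ncard = 14)
    (hm : 13 ≤ M.E.ncard) : ∃ x ∈ M.E, (ThmN.trianglesThrough M x).ncard = 3 := by
  by_contra hne
  have h4 : ∀ y ∈ M.E, 4 ≤ (ThmN.trianglesThrough M y).ncard := fun y hy => by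
    have := hdeg y hy
    by_contra h
    exact hne ⟨y, hy, by omega⟩
  have := S1.mul_ncard_ground_le_three_mul_ncard_triangles M 4 h4
  omega

end TriangleCap

end PercRepro
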